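import Summits.QuantumFields.YangMills.Theorems.LuscherReductionTwistedTraceScalingBOSupportGeometry
import Summits.QuantumFields.YangMills.Theorems.LuscherReductionTwistedTraceScalingBOAssembly
import Summits.QuantumFields.YangMills.Theorems.LuscherReductionTwistedTraceScalingOrthoTubeCoverage
import HarnessLib

/-!
# C4-CORE from the ANALYTIC bricks alone: the structural fields of `BOBricks` for the record weight, discharged
# (lane A of S-BASE, crux `TwistedTraceScaling` stmt-QuantumFields-20203, C4 INNER; design note `pub/ym-fleet/ym-luscher-20007-p1/COARSE-DESIGN.md` §24.7)

`RecordBOInput L s K M` = what a successor must SUPPLY for the record weight `χ = recordWeightRho (Kβ^{-s}) (MKβ^{-s}) β^{-1}`: a fibre profile family `Ω` (measurable, `|Ω| ≤ 1`, colour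
blind, supported in `{‖x‖ ≤ r β}`, `γ > 0`), a slow radius `δ₁` with the SHADOW property (S1) (`U ∈ supp χ`, `orbitDist U < β^{-s}` ⇒ `orbitDist₁(slowMean U) < δ₁`), the radii
inequalities, rates `κ` (dominating every `C·β^{-2s}`, `o(λ_b)`) and `b` (`b² = o(λ_b)`), `σ > 0`, `θ₀ ∈ (0,1]`, and the three ANALYTIC BRICKS (B-T) kernel on BO functions, (B-ST)
stiff domination, (B-OD) off-diagonal — for exactly these data (`w = N/χ`, `𝒰 = {orbitDist₁ < δ₁}`, `γ = boGamma Ω β^{-1} N̄(β^{-1})`).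
★★★ `boBricks_record` fills ALL remaining fields of `BOBricks` (weight measurability/bounds/colour invariance, window measurability/invariance, tube membership
`mem_orthoTubeSet_of_near_one`, BO supports `boFun_support_record`, (B-N) `fibreMass_brick_record` + (P) `fpWeight_core_constant`), and
★★★ `innerNoIntruderOneOrbitAt_of_recordInput : ∃ M₀, ∀ M ≥ M₀, RecordBOInput L s K M → InnerNoIntruderOneOrbitAt L β^{-s}` (`L ≥ 2`, `0 < s ≤ 1/3`, `K ≥ 1`).
HONEST FRAMING: C4-CORE(s) is now EXACTLY (S1) + (B-T) + (B-ST) + (B-OD) (+ the construction of Ω); those are OPEN; C4 OPEN; stub of a child of the CONDITIONAL route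
R2b1; not infinite volume, not a gap, not Clay.
-/

set_option autoImplicit false

noncomputable section

open MeasureTheory Filter Topology Real
open scoped BigOperators
open Literature.MathematicalPhysics.QuantumFieldTheory
open Literature.MathematicalPhysics.QuantumLattice

namespace Summit.QuantumFields.YangMills.Theorems.FemtoTransferGap.TwoLattice.ConstTube

open Summit.QuantumFields.YangMills.Theorems.FemtoTransferGap
open Summit.QuantumFields.YangMills.Theorems.FemtoTransferGap.TwoLattice.Avg
open Summit.QuantumFields.YangMills.Theorems.FemtoTransferGap.TwoLattice.Stiff (LinkSpace)

variable (L : ℕ) [NeZero L]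

/-! ## §1 The record data -/

/-- The record weight with orbit radius `Kβ^{-s}`, link radius `MKβ^{-s}`, gauge width `β^{-1}`. [cite: Luscher1983, §3] -/
def recordChi (s K M : ℝ) : ℝ → GaugeConfig 3 L SU2 → ℝ :=
  recordWeightRho L (fun β => K * powScale s β) (fun b => M * (K * powScale s b)) (powScale 1)

/-- The record fibre-mass constant `γ_β = boGamma Ω_β β^{-1} N̄(β^{-1})`. [folklore] -/
def recordGamma (Ω : ℝ → LinkSpace L → ℝ) (β : ℝ) : ℝ := boGamma L (Ω β) (powScale 1 β) (fpWeightBar L (powScale 1 β))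

/-- **THE INPUT A SUCCESSOR MUST SUPPLY** for the record weight (see the module docstring). [cite: Luscher1983, §3] [cite: SjostrandZworski2007, §2] -/
structure RecordBOInput (s K M : ℝ) where
  /-- fibre profile, its support radius, slow radius, rates and constants -/
  Ω : ℝ → LinkSpace L → ℝ
  r : ℝ → ℝ
  δ₁ : ℝ → ℝ
  σ : ℝ → ℝ
  κ : ℝ → ℝ
  b : ℝ → ℝ
  θ₀ : ℝ
  hΩm : ∀ β, Measurable (Ω β)
  hΩ1 : ∀ β x, |Ω β x| ≤ 1
  hΩinv : ∀ β (g : SU2) (v : LinkSpace L), Ω β (adL L g v) = Ω β v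
  hΩr : ∀ β x, Ω β x ≠ 0 → ‖x‖ ≤ r β
  hr : ∀ β, 0 ≤ r β ∧ r β ≤ 1 / 2
  hγ : ∀ β, 0 < recordGamma L Ω β
  hδ₁ : ∀ᶠ β in atTop, δ₁ β ≤ 1 / 2
  hcore : ∀ᶠ β in atTop, 13 * ((L : ℝ) ^ 3 * β) ^ (-(1 / 5 : ℝ)) < δ₁ β
  hradii : ∀ᶠ β in atTop, (Fintype.card (Edge 3 L) : ℝ) * (4 * r β + δ₁ β) < K * powScale s β
  /-- (S1) the slow shadow of the test support -/
  hshadow : ∀ᶠ β in atTop, ∀ U : GaugeConfig 3 L SU2, recordChi L s K M β U ≠ 0 → orbitDist U < powScale s β → orbitDist (slowMean L U) < δ₁ β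
  hσ : ∀ β, 0 < σ β
  hκ0 : ∀ β, 0 ≤ κ β
  hκ_dom : ∀ C : ℝ, ∀ᶠ β in atTop, C * (K * powScale s β) ^ 2 ≤ κ β
  hκ_small : ∀ a : ℝ, 0 < a → ∀ᶠ β in atTop, κ β ≤ a * bareLambda ((L : ℝ) ^ 3 * β)
  hb : ∀ β, 0 ≤ b β
  hb_small : ∀ a : ℝ, 0 < a → ∀ᶠ β in atTop, b β ^ 2 ≤ a * bareLambda ((L : ℝ) ^ 3 * β)
  hθ₀ : 0 < θ₀ ∧ θ₀ ≤ 1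
  /-- (B-T) the kernel on BO functions -/
  hT : ∀ᶠ β in atTop, ∀ φ : GaugeConfig 3 1 SU2 → ℝ, Measurable φ → (∃ C : ℝ, ∀ u, |φ u| ≤ C) →
    (∀ (g : Site 3 1 → SU2) (u : GaugeConfig 3 1 SU2), φ (gaugeTransform g u) = φ u) → (∀ u, φ u ≠ 0 → orbitDist u < δ₁ β) →
    |tubeForm β (boFun L φ (Ω β)) - σ β * recordGamma L Ω β * qform su2Rep ((L : ℝ) ^ 3 * β) φ φ| ≤
      κ β * (σ β * recordGamma L Ω β) * (qform su2Rep ((L : ℝ) ^ 3 * β) φ φ + levelValue su2Rep 1 ((L : ℝ) ^ 3 * β) 0 * l2 φ φ)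
  /-- (B-ST) stiff domination -/
  hST : ∀ᶠ β in atTop, ∀ v : GaugeConfig 3 L SU2 → ℝ, Measurable v → (∃ C : ℝ, ∀ U, |v U| ≤ C) → (∀ U, v U ≠ 0 → recordChi L s K M β U ≠ 0) →
    (∀ u, fibreInner L (softWeight (recordChi L s K M β)) (Ω β) v u = 0) →
    tubeForm β v ≤ (1 - θ₀) * (σ β * levelValue su2Rep 1 ((L : ℝ) ^ 3 * β) 0) * tubeNormSq (softWeight (recordChi L s K M β)) v
  /-- (B-OD) off-diagonal -/
  hOD : ∀ᶠ β in atTop, ∀ (φ : GaugeConfig 3 1 SU2 → ℝ) (v : GaugeConfig 3 L SU2 → ℝ), Measurable φ → (∃ C : ℝ, ∀ u, |φ u| ≤ C) →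
    (∀ u, φ u ≠ 0 → orbitDist u < δ₁ β) → Measurable v → (∃ C : ℝ, ∀ U, |v U| ≤ C) → (∀ U, v U ≠ 0 → recordChi L s K M β U ≠ 0) →
    (∀ u, fibreInner L (softWeight (recordChi L s K M β)) (Ω β) v u = 0) →
    |tubeCross β (boFun L φ (Ω β)) v| ≤ b β * (σ β * levelValue su2Rep 1 ((L : ℝ) ^ 3 * β) 0) *
        Real.sqrt (tubeNormSq (softWeight (recordChi L s K M β)) (boFun L φ (Ω β))) * Real.sqrt (tubeNormSq (softWeight (recordChi L s K M β)) v) ∧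
    |tubeCross β v (boFun L φ (Ω β))| ≤ b β * (σ β * levelValue su2Rep 1 ((L : ℝ) ^ 3 * β) 0) *
        Real.sqrt (tubeNormSq (softWeight (recordChi L s K M β)) (boFun L φ (Ω β))) * Real.sqrt (tubeNormSq (softWeight (recordChi L s K M β)) v)

variable {L}

/-! ## §2 Elementary properties of the record weight and its soft weight -/

/-- `0 ≤ χ ≤ 1`, `χ` measurable, `χ ≥ e^{−|Edge|β²}` on its support (the support is the fat tube). [folklore] -/
theorem recordChi_props (s K M β : ℝ) :
    Measurable (recordChi L s K M β) ∧ (∀ U, |recordChi L s K M β U| ≤ 1) ∧ (∀ U, 0 ≤ recordChi L s K M β U) ∧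
      ∀ U, recordChi L s K M β U ≠ 0 →
        Real.exp (-((Fintype.card (Edge 3 L) : ℝ) / powScale 1 β ^ 2)) ≤ recordChi L s K M β U ∧
          U ∈ fatTubeRho L (fun β => K * powScale s β) (fun b => M * (K * powScale s b)) β := by
  refine ⟨measurable_recordWeightRho L _ _ _ β, fun U => ?_, fun U => (recordWeightRho_mem_Icc L _ _ _ β U).1, fun U hU => ?_⟩
  · have h := recordWeightRho_mem_Icc L (fun β => K * powScale s β) (fun b => M * (K * powScale s b)) (powScale 1) β U
    show |recordWeightRho L (fun β => K * powScale s β) (fun b => M * (K * powScale s b)) (powScale 1) β U| ≤ 1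
    rw [abs_of_nonneg h.1]; exact h.2
  · have hmem : U ∈ fatTubeRho L (fun β => K * powScale s β) (fun b => M * (K * powScale s b)) β := by
      by_contra h; apply hU; unfold recordChi recordWeightRho; rw [Set.indicator_of_notMem h, zero_mul]
    refine ⟨?_, hmem⟩
    unfold recordChi recordWeightRho
    rw [Set.indicator_of_mem hmem, one_mul]
    exact gaussFactor_ge L (powScale 1) β U

/-- The soft weight `N/χ` of the record weight: measurable, bounded, nonnegative, colour invariant. [folklore] -/
theorem softWeight_recordChi_props (s K M β : ℝ) :
    Measurable (softWeight (recordChi L s K M β)) ∧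
      (∀ U, |softWeight (recordChi L s K M β) U| ≤ Real.exp ((Fintype.card (Edge 3 L) : ℝ) / powScale 1 β ^ 2)) ∧
      (∀ U, 0 ≤ softWeight (recordChi L s K M β) U) ∧
      ∀ (g : SU2) (U : GaugeConfig 3 L SU2), softWeight (recordChi L s K M β) (gaugeTransform (fun _ : Site 3 L => g) U) = softWeight (recordChi L s K M β) U := by
  obtain ⟨hm, h1, h0, hc⟩ := recordChi_props (L := L) s K M β
  have hN0 : ∀ U, 0 ≤ gaugeAvg (recordChi L s K M β) U := fun U => (gaugeAvg_mem_Icc hm (fun V => h0 V) (fun V => (abs_le.mp (h1 V)).2) U).1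
  have hN1 : ∀ U, gaugeAvg (recordChi L s K M β) U ≤ 1 := fun U => (gaugeAvg_mem_Icc hm (fun V => h0 V) (fun V => (abs_le.mp (h1 V)).2) U).2
  refine ⟨(measurable_gaugeAvg hm).div hm, fun U => ?_, fun U => div_nonneg (hN0 U) (h0 U), fun g U => ?_⟩
  · unfold softWeight
    by_cases hU : recordChi L s K M β U = 0
    · rw [hU, div_zero, abs_zero]; exact (Real.exp_pos _).le
    · obtain ⟨hcU, -⟩ := hc U hU
      have hχpos : 0 < recordChi L s K M β U := lt_of_lt_of_le (Real.exp_pos _) hcU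
      rw [abs_of_nonneg (div_nonneg (hN0 U) (h0 U)), div_le_iff₀ hχpos]
      calc gaugeAvg (recordChi L s K M β) U ≤ 1 := hN1 U
        _ = Real.exp ((Fintype.card (Edge 3 L) : ℝ) / powScale 1 β ^ 2) * Real.exp (-((Fintype.card (Edge 3 L) : ℝ) / powScale 1 β ^ 2)) := by
            rw [← Real.exp_add, add_neg_cancel, Real.exp_zero]
        _ ≤ Real.exp ((Fintype.card (Edge 3 L) : ℝ) / powScale 1 β ^ 2) * recordChi L s K M β U := mul_le_mul_of_nonneg_left hcU (Real.exp_pos _).le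
  · unfold softWeight recordChi
    rw [gaugeAvg_gaugeTransform, recordWeightRho_conj]

/-! ## §3 ★★★ The brick list for the record weight -/

/-- ★★★ **`BOBricks` FOR THE RECORD WEIGHT from the input**: all structural fields discharged; (B-N) from (P) (its sandwich on the fat tube with constant `C` is the hypothesis
`hP`, supplied by `fpWeight_core_constant` in the next theorem). [cite: Luscher1983, §3] -/
def boBricks_record {s K M : ℝ} (hs : 0 < s) (hM : 1 ≤ M) (I : RecordBOInput L s K M) {C β₀ : ℝ}
    (hP : ∀ β : ℝ, β₀ ≤ β → ∀ U ∈ fatTubeRho L (fun β => K * powScale s β) (fun b => M * (K * powScale s b)) β,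
      fpWeightBar L (powScale 1 β) * (1 - C * (K * powScale s β) ^ 2) ≤ gaugeAvg (recordChi L s K M β) U ∧
        gaugeAvg (recordChi L s K M β) U ≤ fpWeightBar L (powScale 1 β) * (1 + C * (K * powScale s β) ^ 2)) :
    BOBricks L (recordChi L s K M) (powScale s) where
  Ω := I.Ω
  𝒰 := fun β => {u | orbitDist u < I.δ₁ β}
  σ := I.σ
  γ := recordGamma L I.Ω
  κ := I.κ
  b := I.b
  c := fun β => Real.exp (-((Fintype.card (Edge 3 L) : ℝ) / powScale 1 β ^ 2))
  θ₀ := I.θ₀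
  δ₁ := I.δ₁
  δ₂ := fun β => (Fintype.card (Edge 3 L) : ℝ) * (4 * I.r β + I.δ₁ β)
  m := 1 / (2 * L)
  hχm := fun β => (recordChi_props s K M β).1
  hχ1 := fun β => (recordChi_props s K M β).2.1
  hχ0 := fun β => (recordChi_props s K M β).2.2.1
  hc := fun β => ⟨Real.exp_pos _, fun U hU => ((recordChi_props s K M β).2.2.2 U hU).1⟩
  hwm := fun β => (softWeight_recordChi_props s K M β).1
  hwb := fun β => ⟨_, (softWeight_recordChi_props s K M β).2.1⟩
  hw0 := fun β => (softWeight_recordChi_props s K M β).2.2.1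
  hwinv := fun β => (softWeight_recordChi_props s K M β).2.2.2
  hΩm := I.hΩm
  hΩ1 := I.hΩ1
  hΩinv := I.hΩinv
  h𝒰m := fun β => measurableSet_lt measurable_orbitDist measurable_const
  h𝒰inv := fun β g u => by simp only [Set.mem_setOf_eq, orbitDist_gaugeTransform]
  h𝒰δ₁ := fun β u hu => hu
  hδ₁ := I.hδ₁
  hcore := by filter_upwards [I.hcore] with β hβ u hu; exact lt_trans hu hβ
  htube := by
    -- links within `ρ = MKβ^{-s}` of `1`, eventually `ρ ≤ 1/5` ⇒ `scalarPart ≥ 1 − 1/50`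
    have hρ0 : Tendsto (fun β => M * (K * powScale s β)) atTop (𝓝 0) := by
      have := (tendsto_powScale hs).const_mul K |>.const_mul M; simpa using this
    filter_upwards [hρ0.eventually (gt_mem_nhds (show (0 : ℝ) < 1 / 5 by norm_num))] with β hρ U hU
    obtain ⟨-, hmem⟩ := (recordChi_props s K M β).2.2.2 U hU
    have hlink : ∀ e : Edge 3 L, 1 - 1 / 50 ≤ scalarPart (U e) := fun e => by
      have h1 := hmem.1 e
      have h2 := frobNorm_sub_one_sq_eq_scalarPart (U e)
      have h3 : frobNorm (((U e : SU2) : Matrix (Fin 2) (Fin 2) ℂ) - 1) ^ 2 ≤ (1 / 5) ^ 2 :=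
        pow_le_pow_left₀ (frobNorm_nonneg _) (h1.le.trans hρ.le) 2
      nlinarith [frobNorm_nonneg (((U e : SU2) : Matrix (Fin 2) (Fin 2) ℂ) - 1)]
    exact (mem_orthoTubeSet_of_near_one L (by norm_num) le_rfl hlink).2.1
  hshadow := by filter_upwards [I.hshadow] with β hβ U hU hd; exact hβ U hU hd
  hbo := by
    filter_upwards [I.hradii] with β hrad φ U hφ hU
    have hr := I.hr β
    have hcard1 : (1 : ℝ) ≤ Fintype.card (Edge 3 L) := by
      have : 0 < Fintype.card (Edge 3 L) := Fintype.card_pos_iff.mpr ⟨((fun _ => 0), 0)⟩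
      exact_mod_cast this
    have hpos : 0 ≤ 4 * I.r β + I.δ₁ β := by
      by_contra h; push Not at h
      have : (Fintype.card (Edge 3 L) : ℝ) * (4 * I.r β + I.δ₁ β) < 0 := mul_neg_of_pos_of_neg (by linarith) h
      -- then `K β^{-s} > negative` is no constraint; but `δ₁ < 0` contradicts `φ u ≠ 0 → orbitDist u < δ₁` unless `φ = 0`, in which case `boFun = 0`
      obtain ⟨-, hφU, -⟩ := boFun_ne_zero L hU
      have h1 := hφ _ hφU; have h2 := orbitDist_nonneg (slowMean L U); linarith [hr.1]
    have hρ : 4 * I.r β + I.δ₁ β < M * (K * powScale s β) := by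
      have h1 : 4 * I.r β + I.δ₁ β ≤ (Fintype.card (Edge 3 L) : ℝ) * (4 * I.r β + I.δ₁ β) := by nlinarith
      have h2 : K * powScale s β ≤ M * (K * powScale s β) := by
        have := powScale_pos s β; nlinarith
      linarith
    exact boFun_support_record (δ' := fun β => K * powScale s β) (ρ := fun b => M * (K * powScale s b)) (δg := powScale 1) hφ hr.2 (I.hΩr β) hρ hrad hU
  hm := by positivity
  hm0 := by
    have hL0 : (0 : ℝ) < L := by exact_mod_cast Nat.pos_of_ne_zero (NeZero.ne L)
    exact div_pos one_pos (by linarith)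
  hδ₂ := by
    have hL0 : (0 : ℝ) < L := by exact_mod_cast Nat.pos_of_ne_zero (NeZero.ne L)
    have hρ0 : Tendsto (fun β => K * powScale s β) atTop (𝓝 0) := by
      have := (tendsto_powScale hs).const_mul K; simpa using this
    filter_upwards [I.hradii, hρ0.eventually (gt_mem_nhds (show (0 : ℝ) < 1 / L by positivity))] with β hrad hsmall
    have h1 : (L : ℝ) * ((Fintype.card (Edge 3 L) : ℝ) * (4 * I.r β + I.δ₁ β)) < L * (1 / L) := mul_lt_mul_of_pos_left (hrad.trans hsmall) hL0
    rw [mul_one_div_cancel hL0.ne'] at h1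
    have h2 : (L : ℝ) * (1 / (2 * L)) = 1 / 2 := by field_simp
    calc (L : ℝ) * ((Fintype.card (Edge 3 L) : ℝ) * (4 * I.r β + I.δ₁ β) + 1 / (2 * L))
        = (L : ℝ) * ((Fintype.card (Edge 3 L) : ℝ) * (4 * I.r β + I.δ₁ β)) + L * (1 / (2 * L)) := by ring
      _ < 1 + 1 / 2 := by rw [h2]; linarith
      _ < 2 := by norm_num
  hσ := I.hσ
  hγ := I.hγ
  hκ := I.hκ0
  hb := I.hb
  hθ₀ := I.hθ₀
  hκ_small := I.hκ_small
  hb_small := I.hb_small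
  hN := by
    filter_upwards [I.hradii, I.hκ_dom C, Filter.eventually_ge_atTop β₀] with β hrad hκC hβ u hu
    have hr := I.hr β
    have hu' : orbitDist u ≤ I.δ₁ β := le_of_lt hu
    have hcard1 : (1 : ℝ) ≤ Fintype.card (Edge 3 L) := by
      have : 0 < Fintype.card (Edge 3 L) := Fintype.card_pos_iff.mpr ⟨((fun _ => 0), 0)⟩
      exact_mod_cast this
    have hpos : 0 ≤ 4 * I.r β + I.δ₁ β := by have := orbitDist_nonneg u; linarith [hr.1]
    have hρ : 4 * I.r β + I.δ₁ β < M * (K * powScale s β) := by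
      have h1 : 4 * I.r β + I.δ₁ β ≤ (Fintype.card (Edge 3 L) : ℝ) * (4 * I.r β + I.δ₁ β) := by nlinarith
      have h2 : K * powScale s β ≤ M * (K * powScale s β) := by have := powScale_pos s β; nlinarith
      linarith
    have hfib : ∀ v ∈ capBalancedSet L, I.Ω β (linkEmbed L v) ≠ 0 → orthoTube L u v ∈ fatTubeRho L (fun β => K * powScale s β) (fun b => M * (K * powScale s b)) β :=
      fun v _ hv => orthoTube_mem_fatTubeRho (δ' := fun β => K * powScale s β) (ρ := fun b => M * (K * powScale s b)) hu' hr.2 (I.hΩr β) hρ hrad v hv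
    have h := fibreMass_brick_record (fun β => K * powScale s β) (fun b => M * (K * powScale s b)) (powScale 1) β (hP β hβ) (I.hΩm β) (I.hΩ1 β) (I.hΩr β) hfib
    have hγ0 : 0 ≤ recordGamma L I.Ω β := (I.hγ β).le
    refine h.trans ?_
    show C * (K * powScale s β) ^ 2 * recordGamma L I.Ω β ≤ I.κ β * recordGamma L I.Ω β
    exact mul_le_mul_of_nonneg_right hκC hγ0
  hT := by filter_upwards [I.hT] with β hβ φ h1 h2 h3 h4; exact hβ φ h1 h2 h3 h4
  hST := I.hST
  hOD := by filter_upwards [I.hOD] with β hβ φ v h1 h2 h3 h4 h5 h6 h7; exact hβ φ v h1 h2 h3 h4 h5 h6 h7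

/-! ## §4 ★★★ C4-CORE from the input -/

/-- ★★★ **C4-CORE(s) FROM THE ANALYTIC INPUT**: for `L` with a nonzero site, `0 < s ≤ 1/3`, `K ≥ 1`: there is `M₀ ≥ 2` such that for every `M ≥ M₀`, a `RecordBOInput L s K M`
(fibre profile + shadow (S1) + radii + the three analytic bricks (B-T)/(B-ST)/(B-OD)) yields `InnerNoIntruderOneOrbitAt L β^{-s}`.  ((P) `fpWeight_core_constant` supplies (B-N);
`boBricks_record` the structure; `softTubeBOPackageOn_of_bricks` the package; `innerNoIntruderOneOrbitAt_of_bigRecordWeight_packageOn` the crux.) [cite: Luscher1983, §3] -/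
theorem innerNoIntruderOneOrbitAt_of_recordInput (hL : Nonempty (NzSite L)) {s : ℝ} (hs : 0 < s) (hs3 : s ≤ 1 / 3) {K : ℝ} (hK : 1 ≤ K) :
    ∃ M₀ : ℝ, 2 ≤ M₀ ∧ ∀ M : ℝ, M₀ ≤ M → RecordBOInput L s K M → InnerNoIntruderOneOrbitAt L (powScale s) := by
  have hδ0 : ∀ β, 0 < K * powScale s β := fun β => mul_pos (by linarith) (powScale_pos s β)
  have hδt : Tendsto (fun β => K * powScale s β) atTop (𝓝 0) := by
    have := (tendsto_powScale hs).const_mul K; simpa using this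
  have hsd : ∀ᶠ β in atTop, 0 < powScale 1 β ∧ powScale 1 β ≤ (K * powScale s β) ^ 3 := by
    filter_upwards [Filter.eventually_ge_atTop (1 : ℝ)] with β hβ
    refine ⟨powScale_pos 1 β, (powScale_one_le_cube hs3 hβ).trans ?_⟩
    have hp := powScale_pos s β
    have h1 : powScale s β ≤ K * powScale s β := by nlinarith
    exact pow_le_pow_left₀ hp.le h1 3
  obtain ⟨M₀, hM₀, hPM⟩ := fpWeight_core_constant L hL hδ0 hδt hsd
  refine ⟨M₀, hM₀, fun M hM I => ?_⟩
  obtain ⟨C, β₀, -, hP⟩ := hPM M hM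
  have hM1 : 1 ≤ M := by linarith
  have B : BOBricks L (recordChi L s K M) (powScale s) := boBricks_record hs hM1 I (C := C) (β₀ := β₀) fun β hβ U hU => hP β hβ U hU
  exact innerNoIntruderOneOrbitAt_of_bigRecordWeight_packageOn (δ := powScale s) (δ' := fun β => K * powScale s β)
    (ρ := fun b => M * (K * powScale s b)) (δg := powScale 1) (fun β => powScale_pos s β)
    (fun β => by have := powScale_pos s β; show powScale s β ≤ K * powScale s β; nlinarith)
    (fun β => by
      have hp := powScale_pos s β
      show 2 * (K * powScale s β) ≤ M * (K * powScale s β)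
      have hM2 : 2 ≤ M := hM₀.trans hM
      have : 0 ≤ K * powScale s β := (hδ0 β).le
      nlinarith)
    (softTubeBOPackageOn_of_bricks B)

end Summit.QuantumFields.YangMills.Theorems.FemtoTransferGap.TwoLattice.ConstTube

end
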